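import Mathlib.Analysis.InnerProductSpace.PiL2
import Mathlib.Tactic

/-!
# Cap bubbles missing the wedge lie in `range ι`
(registered helper `helper_offWedgeMemRange` of line `cross-cap-laurent`, crux
`GromovRecognitionRelEnd`, item stmt-SmoothPoincare4-11009)

The wedge cap `X = ι(M) ⊔ (H∞ ∪ V∞)` of a 4-manifold `M` is covered by `range ι` and three polydisc
cap charts `ηV, ηH, ηC : ℝ⁴ → X` (coordinates `p 0, p 1` = first complex factor, `p 2, p 3` =
second factor), glued to `ι ∘ χ` by complex inversion of one factor off the corresponding axis.
The two spheres at infinity are `H∞ = ηH {p 2 = p 3 = 0} ∪ {ηC 0}` and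
`V∞ = ηV {q 0 = q 1 = 0} ∪ {ηC 0}`.  This file proves the purely logical fact that a point `y : X`
which is neither on the `H`-axis image, nor on the `V`-axis image, nor the corner `ηC 0`, lies in
`range ι`: run through the cover clause and, in each chart, either a gluing clause rewrites the
chart value as a value of `ι ∘ χ`, or the point is forced onto one of the two axes / the corner.
-/

-- the prescribed namespace `Summit.<P>.<Sub>.…` duplicates `SmoothPoincare4` (P = Sub)
set_option linter.dupNamespace false

namespace Summit.SmoothPoincare4.SmoothPoincare4.Theorems.GromovRecognitionRelEnd.CrossCapLaurent

/-- **Cap bubbles missing the wedge lie in `range ι`.**  Given the four gluing clauses of the three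
cap charts `ηV, ηH, ηC` of the wedge cap with `ι ∘ χ` and the cover clause (every point of `X` is in
`range ι` or in the image of one of the three polydiscs), a point `y : X` off the `H`-axis image
`ηH {p 2 = p 3 = 0}`, off the `V`-axis image `ηV {q 0 = q 1 = 0}` and different from the corner
`ηC 0` lies in `Set.range ι`. -/
theorem helper_offWedgeMemRange : ∀ (M : Type) (X : Type) (R₁ : ℝ) (χ : EuclideanSpace ℝ (Fin 4) → M) (ι : M → X) (ηH ηV ηC : EuclideanSpace ℝ (Fin 4) → X), (∀ p : EuclideanSpace ℝ (Fin 4), p 0 ^ 2 + p 1 ^ 2 < R₁⁻¹ ^ 2 → (p 0 ≠ 0 ∨ p 1 ≠ 0) → ηV p = ι (χ (WithLp.toLp 2 ![p 0 / (p 0 ^ 2 + p 1 ^ 2), -(p 1) / (p 0 ^ 2 + p 1 ^ 2), p 2, p 3]))) → (∀ p : EuclideanSpace ℝ (Fin 4), p 2 ^ 2 + p 3 ^ 2 < R₁⁻¹ ^ 2 → (p 2 ≠ 0 ∨ p 3 ≠ 0) → ηH p = ι (χ (WithLp.toLp 2 ![p 0, p 1, p 2 / (p 2 ^ 2 + p 3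 ^ 2), -(p 3) / (p 2 ^ 2 + p 3 ^ 2)]))) → (∀ p : EuclideanSpace ℝ (Fin 4), p 0 ^ 2 + p 1 ^ 2 < R₁⁻¹ ^ 2 → p 2 ^ 2 + p 3 ^ 2 < R₁⁻¹ ^ 2 → (p 2 ≠ 0 ∨ p 3 ≠ 0) → ηC p = ηV (WithLp.toLp 2 ![p 0, p 1, p 2 / (p 2 ^ 2 + p 3 ^ 2), -(p 3) / (p 2 ^ 2 + p 3 ^ 2)])) → (∀ p : EuclideanSpace ℝ (Fin 4), p 0 ^ 2 + p 1 ^ 2 < R₁⁻¹ ^ 2 → p 2 ^ 2 + p 3 ^ 2 < R₁⁻¹ ^ 2 → (p 0 ≠ 0 ∨ p 1 ≠ 0) → ηC p = ηH (WithLp.toLp 2 ![p 0 / (p 0 ^ 2 + p 1 ^ 2), -(p 1) / (p 0 ^ 2 + p 1 ^ 2), p 2, p 3])) → (∀ y : X, y ∈ Set.range ι ∨ (∃ p : EuclideanSpace ℝ (Fin 4), p 0 ^ 2 + p 1 ^ 2 < R₁⁻¹ ^ 2 ∧ ηV p = y) ∨ (∃ p : EuclideanSpace ℝ (Fin 4),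 p 2 ^ 2 + p 3 ^ 2 < R₁⁻¹ ^ 2 ∧ ηH p = y) ∨ (∃ p : EuclideanSpace ℝ (Fin 4), (p 0 ^ 2 + p 1 ^ 2 < R₁⁻¹ ^ 2 ∧ p 2 ^ 2 + p 3 ^ 2 < R₁⁻¹ ^ 2) ∧ ηC p = y)) → ∀ y : X, (∀ p : EuclideanSpace ℝ (Fin 4), p 2 = 0 → p 3 = 0 → ηH p ≠ y) → (∀ q : EuclideanSpace ℝ (Fin 4), q 0 = 0 → q 1 = 0 → ηV q ≠ y) → y ≠ ηC 0 → y ∈ Set.range ι := by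
  intro M X R₁ χ ι ηH ηV ηC hV hH hCV hCH hcover y hHaxis hVaxis hC0
  rcases hcover y with hy | ⟨p, hp, rfl⟩ | ⟨p, hp, rfl⟩ | ⟨p, ⟨hp₁, hp₂⟩, rfl⟩
  · -- `y ∈ range ι` already
    exact hy
  · -- `y = ηV p`, `p` in the `V`-polydisc: off the `V`-axis the first gluing clause applies
    by_cases h01 : p 0 ≠ 0 ∨ p 1 ≠ 0
    · exact ⟨_, (hV p hp h01).symm⟩
    · push Not at h01
      exact absurd rfl (hVaxis p h01.1 h01.2)
  · -- `y = ηH p`, `p` in the `H`-polydisc: off the `H`-axis the second gluing clause applies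
    by_cases h23 : p 2 ≠ 0 ∨ p 3 ≠ 0
    · exact ⟨_, (hH p hp h23).symm⟩
    · push Not at h23
      exact absurd rfl (hHaxis p h23.1 h23.2)
  · -- `y = ηC p`, `p` in the corner bidisc
    by_cases h23 : p 2 ≠ 0 ∨ p 3 ≠ 0
    · -- invert the second factor: `ηC p = ηV q` with `q 0 = p 0`, `q 1 = p 1`
      have hq := hCV p hp₁ hp₂ h23
      have hq0 : (WithLp.toLp 2 ![p 0, p 1, p 2 / (p 2 ^ 2 + p 3 ^ 2),
          -(p 3) / (p 2 ^ 2 + p 3 ^ 2)] : EuclideanSpace ℝ (Fin 4)) 0 = p 0 := by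
        simp
      have hq1 : (WithLp.toLp 2 ![p 0, p 1, p 2 / (p 2 ^ 2 + p 3 ^ 2),
          -(p 3) / (p 2 ^ 2 + p 3 ^ 2)] : EuclideanSpace ℝ (Fin 4)) 1 = p 1 := by
        simp
      by_cases h01 : p 0 ≠ 0 ∨ p 1 ≠ 0
      · -- `q` is off the `V`-axis and in the `V`-polydisc: first gluing clause
        rw [hq]
        refine ⟨_, (hV _ ?_ ?_).symm⟩
        · rw [hq0, hq1]
          exact hp₁
        · rw [hq0, hq1]
          exact h01
      · -- `q` is a `V`-axis point: contradiction
        push Not at h01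
        exact absurd hq.symm (hVaxis _ (hq0.trans h01.1) (hq1.trans h01.2))
    · push Not at h23
      by_cases h01 : p 0 ≠ 0 ∨ p 1 ≠ 0
      · -- invert the first factor: `ηC p = ηH q'` with `q'` an `H`-axis point: contradiction
        have hq := hCH p hp₁ hp₂ h01
        refine absurd hq.symm (hHaxis _ ?_ ?_)
        · simp [h23.1]
        · simp [h23.2]
      · -- all four coordinates vanish: `p = 0`, `y = ηC 0`: contradiction
        push Not at h01
        have hp0 : p = 0 := by
          ext i
          fin_cases i
          · simpa using h01.1
          · simpa using h01.2
          · simpa using h23.1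
          · simpa using h23.2
        exact absurd (congrArg ηC hp0) hC0

end Summit.SmoothPoincare4.SmoothPoincare4.Theorems.GromovRecognitionRelEnd.CrossCapLaurent
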